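import Literature.NumberTheory.Transcendental.KZDilationStokesDescent
import HarnessLib

/-!
# Stokes descent for the dilation pencil, VI: the descended data in any dimension

General-`d` packaging of the Stokes descent (`KZDilationStokesDescent.lean`): for a rational potential
`B = P/Q ∈ ℚ(x₀, …, x_d)` regular on the box `(a,b)^{1+d} ⊇ [0,1]^{1+d}` and `h = ∂₀B`,
  `v_h(ϖ) = v_{Kn/Kd}(ϖ) + (ϖ − 1)·∫_{[0,1]^d} K(ϖ, ϖu) du`   on all of `[0,1]`,
where the DESCENDED DATA `Kn/Kd ∈ ℚ(x₁, …, x_d)` are the explicit `d`-variable polynomials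
`Kn = P(1,·)Q(0,·) − P(0,·)Q(1,·)`, `Kd = Q(1,·)Q(0,·)` (faces by `MvPolynomial.bind₁`), regular on the
box `(a,b)^d`, and `K` is a kernel Nash on `(a,b)^{1+d}` (`exists_stokes_repr`). So `x₀`-exact rational
data of dimension `d + 1` reduce, for the dilation lifting problem at `1` (crux `DilationLiftAtOne`,
route `KontsevichZagierPeriods/LiftingCriteria`), to general rational data of dimension `d` plus a
twisted-diagonal kernel — the induction step of the iterated-Stokes ("fully exact") sector.

Everything is proved; no `def`, no named fact.

## References
* M. Kontsevich, D. Zagier, *Periods* (2001), §1.2. [`KontsevichZagier2001`]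
-/

noncomputable section

open Set MeasureTheory
open scoped BigOperators Topology
open Literature.ModelTheory.ExponentialFields (IsSemialgebraic)

namespace Literature.NumberTheory.Transcendental

namespace KZ.StokesDescent

variable {d : ℕ}

/-- Faces of box points: `w ∈ (a,b)^d`, `c ∈ (a,b)` ⇒ `Fin.cons c w ∈ (a,b)^{1+d}`. [folklore] -/
theorem cons_mem_box {a b c : ℝ} (hc : c ∈ Ioo a b) {w : Fin d → ℝ}
    (hw : w ∈ Set.pi Set.univ (fun _ : Fin d => Ioo a b)) :
    (Fin.cons c w : Fin (d + 1) → ℝ) ∈ Set.pi Set.univ (fun _ : Fin (d + 1) => Ioo a b) := by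
  rw [Set.mem_univ_pi] at hw ⊢
  refine Fin.cases ?_ (fun j => ?_)
  · simpa using hc
  · simpa using hw j

/-- **Stokes descent with explicit descended data (any dimension).** See the module docstring.
[cite: KontsevichZagier2001, §1.2] -/
theorem exists_stokes_repr {a b : ℚ} (ha : (a:ℝ) < 0) (hb : 1 < (b:ℝ))
    (P Q : MvPolynomial (Fin (d + 1)) ℚ)
    (hQ : ∀ p ∈ Set.pi Set.univ (fun _ : Fin (d + 1) => Ioo (a:ℝ) b), MvPolynomial.aeval p Q ≠ 0) :
    ∃ (K : (Fin (d + 1) → ℝ) → ℝ),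
      IsSemialgebraicFunOn ℚ (Set.pi Set.univ (fun _ : Fin (d + 1) => Ioo (a:ℝ) b)) K ∧
      AnalyticOnNhd ℝ K (Set.pi Set.univ (fun _ : Fin (d + 1) => Ioo (a:ℝ) b)) ∧
      (∀ w ∈ Set.pi Set.univ (fun _ : Fin d => Ioo (a:ℝ) b), MvPolynomial.aeval w
        (MvPolynomial.bind₁ (Fin.cons (MvPolynomial.C 1) MvPolynomial.X :
            Fin (d + 1) → MvPolynomial (Fin d) ℚ) Q *
          MvPolynomial.bind₁ (Fin.cons (MvPolynomial.C 0) MvPolynomial.X :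
            Fin (d + 1) → MvPolynomial (Fin d) ℚ) Q) ≠ 0) ∧
      ∀ ϖ ∈ Icc (0:ℝ) 1,
        (∫ z in Set.pi Set.univ (fun _ : Fin (d + 1) => Icc (0:ℝ) 1),
          (MvPolynomial.aeval (ϖ • z) (MvPolynomial.pderiv 0 P) * MvPolynomial.aeval (ϖ • z) Q -
              MvPolynomial.aeval (ϖ • z) P * MvPolynomial.aeval (ϖ • z) (MvPolynomial.pderiv 0 Q)) /
            (MvPolynomial.aeval (ϖ • z) Q) ^ 2) =
          (∫ u in Set.pi Set.univ (fun _ : Fin d => Icc (0:ℝ) 1),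
            MvPolynomial.aeval (ϖ • u)
                (MvPolynomial.bind₁ (Fin.cons (MvPolynomial.C 1) MvPolynomial.X :
                    Fin (d + 1) → MvPolynomial (Fin d) ℚ) P *
                  MvPolynomial.bind₁ (Fin.cons (MvPolynomial.C 0) MvPolynomial.X :
                    Fin (d + 1) → MvPolynomial (Fin d) ℚ) Q -
                MvPolynomial.bind₁ (Fin.cons (MvPolynomial.C 0) MvPolynomial.X :
                    Fin (d + 1) → MvPolynomial (Fin d) ℚ) P *
                  MvPolynomial.bind₁ (Fin.cons (MvPolynomial.C 1) MvPolynomial.X :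
                    Fin (d + 1) → MvPolynomial (Fin d) ℚ) Q) /
              MvPolynomial.aeval (ϖ • u)
                (MvPolynomial.bind₁ (Fin.cons (MvPolynomial.C 1) MvPolynomial.X :
                    Fin (d + 1) → MvPolynomial (Fin d) ℚ) Q *
                  MvPolynomial.bind₁ (Fin.cons (MvPolynomial.C 0) MvPolynomial.X :
                    Fin (d + 1) → MvPolynomial (Fin d) ℚ) Q)) +
          (ϖ - 1) * ∫ u in Set.pi Set.univ (fun _ : Fin d => Icc (0:ℝ) 1),
            K (Matrix.vecCons ϖ (ϖ • u)) := by
  obtain ⟨N₁, hN⟩ := exists_stokes_quotient P Q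
  have hface : ∀ (c : ℚ) (f : MvPolynomial (Fin (d + 1)) ℚ) (u : Fin d → ℝ),
      MvPolynomial.aeval u (MvPolynomial.bind₁ (Fin.cons (MvPolynomial.C c) MvPolynomial.X :
        Fin (d + 1) → MvPolynomial (Fin d) ℚ) f) =
        MvPolynomial.aeval (Matrix.vecCons (c:ℝ) u) f :=
    fun c f u => aeval_bind₁_cons u f c
  have h0 : (0:ℝ) ∈ Ioo (a:ℝ) b := ⟨ha, zero_lt_one.trans hb⟩
  have h1 : (1:ℝ) ∈ Ioo (a:ℝ) b := ⟨ha.trans zero_lt_one, hb⟩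
  refine ⟨fun p => MvPolynomial.aeval p N₁ / (MvPolynomial.aeval p Q *
      MvPolynomial.aeval (Matrix.vecCons 0 (Matrix.vecTail p)) Q *
      MvPolynomial.aeval (Matrix.vecCons 1 (Matrix.vecTail p)) Q),
    isSemialgebraicFunOn_kernel ha hb Q N₁ hQ, analyticOnNhd_kernel ha hb Q N₁ hQ, ?_, ?_⟩
  · intro w hw
    rw [map_mul, hface, hface, Rat.cast_one, Rat.cast_zero]
    exact mul_ne_zero (hQ _ (cons_mem_box h1 hw)) (hQ _ (cons_mem_box h0 hw))
  · intro ϖ hϖ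
    rw [dilation_integral_pderiv_zero ha hb P Q N₁ hQ hN hϖ]
    congr 1
    refine setIntegral_congr_fun (MeasurableSet.univ_pi fun _ => measurableSet_Icc) fun u hu => ?_
    have huI : ϖ • u ∈ Set.pi Set.univ (fun _ : Fin d => Ioo (a:ℝ) b) :=
      cube_subset_box ha hb (smul_mem_cube hϖ hu)
    simp only [map_sub, map_mul, hface, Rat.cast_one, Rat.cast_zero]
    have hQ0 : MvPolynomial.aeval (Matrix.vecCons (0:ℝ) (ϖ • u)) Q ≠ 0 := hQ _ (cons_mem_box h0 huI)
    have hQ1 : MvPolynomial.aeval (Matrix.vecCons (1:ℝ) (ϖ • u)) Q ≠ 0 := hQ _ (cons_mem_box h1 huI)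
    field_simp

end KZ.StokesDescent

end Literature.NumberTheory.Transcendental
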